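import Literature.AnabelianGeometry.EtaleTheta.SettingModelSlice2Uhat
import Literature.AnabelianGeometry.EtaleTheta.SettingModelSlice1Assembly
import HarnessLib

/-!
# (L3′) slice 2, file 4/13 — the residual hypotheses `Residual` (PL3-R2 S0 in OUR vocabulary), cusp-line malnormality, S1 (the axis via Cor R1′ = `Slice1.torusStable_holds`)

Part of the (L3′) slice-2 chain (abc-iut-L6-t19; FILING SHAPE derived from scratch v5 `Slice2TheoremR2ScratchV5.lean`
551b982286441a66 by the edits E1–E4/D1–D3/H1–H2 of FILING-PLAN-SLICE2.md 9643c7e42a42ad24 and the OPTION-L re-cut of §F v1.19gz (W):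
one definitions file + twelve theorem files).  Classical profinite group theory about OUR semi-synthetic `F₂hatT`; the objects and laws
are those of the one-sentence residual of record (cf. [EtTh] §1, §2 for the role they play there — nothing of [EtTh]/[IUTchII]/[IUTchIII]
in print is asserted; no side on [IUTchIII] Cor. 3.12; MORATORIUM (E): no application to `hext_at_iff_exists_f2hatAut_of_eq`).
-/

noncomputable section

open scoped Pointwise

namespace Literature.AnabelianGeometry.EtaleTheta.SettingModel.Slice2

open Literature.AnabelianGeometry.EtaleTheta.SettingModel
open Literature.AnabelianGeometry.EtaleTheta (ZHatLevel.level ZHatLevel.levelChar)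
open Literature.AnabelianGeometry.SemiGraphs (GQp)
open Literature.AnabelianGeometry.AbsoluteAnabelian
open Literature.AnabelianGeometry.AbsoluteAnabelian.AbsTopII
open _root_.Topology

/-- **Conjugation commutes with `Ẑ`-powers**: `(g x g⁻¹)^t = g x^t g⁻¹` — a file-private copy of the landed
`SettingModel.powHat_conj` (its home is an (E)-class module that this chain does not import; R2′ of §F v1.19gz (W)(4)).
[cite: MochizukiEtTh2009, §1 p.12] -/
private theorem powHat_conj (g x : F₂hatT) (t : ZH) : powHat (g * x * g⁻¹) t = g * powHat x t * g⁻¹ := by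
  let C : F₂hatT →ₜ* F₂hatT :=
    { toMonoidHom := (MulAut.conj g).toMonoidHom
      continuous_toFun := (continuous_const.mul continuous_id).mul continuous_const }
  have hC : ∀ y, C y = g * y * g⁻¹ := fun _ => rfl
  have h := map_powHat C x t
  rw [hC, hC] at h
  exact h.symm

/-! ## §5 THE RESIDUAL HYPOTHESES (PL3-R2 S0, verbatim in OUR vocabulary) -/

section Residual

variable (p : ℕ) [Fact p.Prime]

variable {p} {l : ℕ+} {U₀ : Subgroup (GQp p)} {m : ℕ+} {f' : F₂hatT} {Ψ : F₂hatT → F₂hatT}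

/-- `level l (k^m) = 1` when `l ∣ m`. [cite: MochizukiEtTh2009, §1 p.12] -/
theorem level_pow_eq_one_of_dvd (hlm : (l : ℕ) ∣ m) (k : ZH) : ZHatLevel.level l (k ^ (m : ℕ)) = 1 := by
  obtain ⟨c, hc⟩ := hlm
  rw [hc, pow_mul, map_pow, ZHatLevel.level_pow_self, one_pow]

namespace Residual

/-- `Ψ′(x^n) = (Ψ′ x)^n` on `Û_l`. [cite: MochizukiEtTh2009, §1 p.12] -/
theorem psi_pow (h : Residual p l U₀ m f' Ψ) {x : F₂hatT} (hx : x ∈ Uhat l) (n : ℕ) : Ψ (x ^ n) = Ψ x ^ n := by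
  induction n with
  | zero => rw [pow_zero, pow_zero, h.psi_one]
  | succ n ih => rw [pow_succ, pow_succ, h.mul _ (pow_mem hx n) _ hx, ih]

/-- **`Ψ′` commutes with `Ẑ`-powers on `Û_l`**: `Ψ′(x^t) = (Ψ′ x)^t`. [cite: MochizukiEtTh2009, §1 p.12] -/
theorem psi_powHat (h : Residual p l U₀ m f' Ψ) {x : F₂hatT} (hx : x ∈ Uhat l) (t : ZH) :
    Ψ (powHat x t) = powHat (Ψ x) t := by
  -- the continuous hom `t ↦ Ψ′(x^t)` through `Û_l`
  let P : ZH →ₜ* Uhat l :=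
    { toMonoidHom := (powHat x).toMonoidHom.codRestrict (Uhat l) (fun t => powHat_mem_Uhat hx t)
      continuous_toFun := (powHat x).continuous.subtype_mk _ }
  let F : ZH →ₜ* F₂hatT :=
    { toMonoidHom := h.hom.comp P.toMonoidHom
      continuous_toFun := h.cont.comp P.continuous }
  have hF : ∀ t, F t = Ψ (powHat x t) := fun _ => rfl
  have key := powHat_unique (Ψ x) F (by rw [hF, powHat_iotaZ_one])
  rw [← hF, key]

/-- `Ψ′(b^u) ∈ B`. [cite: MochizukiEtTh2009, §1 p.12] -/
theorem psi_bPow_mem_bAxis (h : Residual p l U₀ m f' Ψ) (u : ZH) : Ψ (bPow u) ∈ bAxis :=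
  (h.axis _ (bPow_mem_Uhat u)).1 (bPow_mem_bAxis u)

/-- `Ψ′(b) ≠ 1`. [cite: MochizukiEtTh2009, §1 p.12] -/
theorem psi_eb_ne_one (h : Residual p l U₀ m f' Ψ) : Ψ eb ≠ 1 := fun h1 =>
  DehnTwist.eta_one_ne_one (h.inj eb eb_mem_Uhat 1 (one_mem _) (by rw [h1, h.psi_one]))

/-- **R1A Prop R1b (3), coarse half — the unipotent cocycle is `B`-valued**: from (B) and `D′_t|_B = id`, every
cocycle value `e_t` of (D′) centralises `Ψ′(b) ∈ B ∖ 1`, hence lies on `B` (`C_F(b^{m₀}) = B`).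
[cite: MochizukiEtTh2009, §1 p.12] -/
theorem dlaw_bAxis (h : Residual p l U₀ m f' Ψ) (k : ZH) :
    ∃ e ∈ bAxis, ∀ x ∈ Uhat l, Ψ (Dp (k ^ (m : ℕ)) x) = e * Dp (k ^ (m : ℕ)) (Ψ x) * e⁻¹ := by
  obtain ⟨e, he⟩ := h.dlaw k
  refine ⟨e, ?_, he⟩
  obtain ⟨m₀, hm₀⟩ := (mem_bAxis_iff _).1 (h.psi_bPow_mem_bAxis (iotaZ (Multiplicative.ofAdd 1)))
  rw [bPow_iotaZ_one] at hm₀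
  have hne : bPow m₀ ≠ 1 := by rw [hm₀]; exact h.psi_eb_ne_one
  have h1 := he (bPow (iotaZ (Multiplicative.ofAdd 1))) (bPow_mem_Uhat _)
  rw [Dp_bPow, bPow_iotaZ_one, ← hm₀, Dp_bPow] at h1
  -- `h1 : b^{m₀} = e b^{m₀} e⁻¹`
  apply DehnTwist.mem_nodeGp_of_commute_bPow hne
  calc e * bPow m₀ = e * bPow m₀ * e⁻¹ * e := by group
    _ = bPow m₀ * e := by rw [← h1]

end Residual

end Residual

/-! ## §6 Lines: malnormality consequences (`C_F(b^μ) = B`, `B ∩ gBg⁻¹ = 1` for `g ∉ B`) -/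

/-- `a^s ∈ B ↔ s = 1` (degrees). [cite: MochizukiEtTh2009, §1 p.12] -/
theorem aPow_mem_bAxis_iff (s : ZH) : aPow s ∈ bAxis ↔ s = 1 := by
  refine ⟨fun h => ?_, fun h => by rw [h, aPow_one]; exact one_mem _⟩
  have := eHat_eq_one_of_mem_bAxis h
  rwa [eHat_aPow] at this

/-- `b^t = 1 ↔ t = 1`. [cite: MochizukiEtTh2009, §1 p.12] -/
theorem bPow_eq_one_iff (t : ZH) : bPow t = 1 ↔ t = 1 := by
  rw [← map_one bPow]; exact bPow_injective.eq_iff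

/-- `β_s^t = 1 ↔ t = 1`. [cite: MochizukiEtTh2009, §1 p.12] -/
theorem betaPow_eq_one_iff (s t : ZH) : betaPow s t = 1 ↔ t = 1 := by
  rw [betaPow, mul_inv_eq_one, mul_eq_left, bPow_eq_one_iff]

/-- **Malnormality, element form**: if `g b^ν g⁻¹ ∈ B` with `b^ν ≠ 1` then `g ∈ B`. [cite: MochizukiSemiAnbd2006, Ex. 2.10 p.31] -/
theorem mem_bAxis_of_conj_bPow_mem {g : F₂hatT} {ν : ZH} (hν : bPow ν ≠ 1) (h : g * bPow ν * g⁻¹ ∈ bAxis) :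
    g ∈ bAxis := by
  by_contra hg
  have hbot := DehnTwist.bAxis_inf_conj_eq_bot_of_not_mem hg
  have hmem : g * bPow ν * g⁻¹ ∈ bAxis ⊓ MulAut.conj g • bAxis := by
    refine Subgroup.mem_inf.mpr ⟨h, ?_⟩
    rw [Subgroup.mem_smul_pointwise_iff_exists]
    exact ⟨bPow ν, bPow_mem_bAxis ν, rfl⟩
  rw [hbot, Subgroup.mem_bot, mul_inv_eq_one, mul_eq_left] at hmem
  exact hν hmem

/-- **Centraliser of a non-trivial `b`-power is `B`** (re-export of `DehnTwist.mem_nodeGp_of_commute_bPow`).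
[cite: MochizukiAbsTopII2013, Prop 1.3 (ii) p.11] -/
theorem mem_bAxis_of_commute_bPow {u : ZH} (hu : bPow u ≠ 1) {x : F₂hatT} (h : x * bPow u = bPow u * x) :
    x ∈ bAxis :=
  DehnTwist.mem_nodeGp_of_commute_bPow hu h

/-- **Commuting non-trivial `b`-type elements lie on the same line**: if `g b^μ g⁻¹` and `h b^ν h⁻¹` commute
(`b^μ, b^ν ≠ 1`) then `g⁻¹ h ∈ B`. [cite: MochizukiSemiAnbd2006, Ex. 2.10 p.31] -/
theorem inv_mul_mem_bAxis_of_commute {g h : F₂hatT} {μ ν : ZH} (hμ : bPow μ ≠ 1) (hν : bPow ν ≠ 1)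
    (hc : (g * bPow μ * g⁻¹) * (h * bPow ν * h⁻¹) = (h * bPow ν * h⁻¹) * (g * bPow μ * g⁻¹)) :
    g⁻¹ * h ∈ bAxis := by
  -- `w := (g⁻¹h) b^ν (g⁻¹h)⁻¹` commutes with `b^μ`
  set w := g⁻¹ * h * bPow ν * (g⁻¹ * h)⁻¹ with hw
  have hcomm : w * bPow μ = bPow μ * w := by
    rw [hw, mul_inv_rev, inv_inv]
    calc g⁻¹ * h * bPow ν * (h⁻¹ * g) * bPow μ
        = g⁻¹ * (h * bPow ν * h⁻¹ * (g * bPow μ * g⁻¹)) * g := by group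
      _ = g⁻¹ * (g * bPow μ * g⁻¹ * (h * bPow ν * h⁻¹)) * g := by rw [hc]
      _ = bPow μ * (g⁻¹ * h * bPow ν * (h⁻¹ * g)) := by group
  have hwB : w ∈ bAxis := mem_bAxis_of_commute_bPow hμ hcomm
  rw [hw] at hwB
  exact mem_bAxis_of_conj_bPow_mem hν hwB

/-- **Distinct axis lines carry non-commuting cusps**: if `β_s^μ` and `β_{s'}^ν` commute (`μ, ν` non-trivial)
then `s = s'`. [cite: MochizukiSemiAnbd2006, Ex. 2.10 p.31] -/
theorem eq_of_betaPow_commute {s s' μ ν : ZH} (hμ : bPow μ ≠ 1) (hν : bPow ν ≠ 1)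
    (hc : betaPow s μ * betaPow s' ν = betaPow s' ν * betaPow s μ) : s = s' := by
  have h := inv_mul_mem_bAxis_of_commute hμ hν hc
  rw [← aPow_inv, ← aPow_mul, aPow_mem_bAxis_iff, inv_mul_eq_one] at h
  exact h

/-- Two elements of the same line: `β_s^μ` and `β_s^ν` commute. [cite: MochizukiEtTh2009, §1 p.12] -/
theorem betaPow_comm (s μ ν : ZH) : betaPow s μ * betaPow s ν = betaPow s ν * betaPow s μ := by
  rw [← betaPow_mul, ZHatCompletion.mul_comm, betaPow_mul]

/-! ## §7 (S1 of PL3-R2) THE AXIS: `Ψ′(b) = b^{m₀}`, `Ψ′(A) = A^ν`-shape, `Ψ′(cusp) = β_{s}^{m}` via Cor R1′ -/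

section S1

variable {p : ℕ} [Fact p.Prime] {l : ℕ+} {U₀ : Subgroup (GQp p)} {m : ℕ+} {f' : F₂hatT} {Ψ : F₂hatT → F₂hatT}

/-- **TORUS-STABLE `b`-TYPE ELEMENTS LIE ON AXIS LINES** (the S1/S7/S8′ device): if `y = g b^μ g⁻¹`, `b^μ ≠ 1`,
satisfies `θ_{χσ}(y) = y^{χσ(1)}` for all `σ` in a finite-index `U`, then `y = β_s^μ` for some `s` — by
`C_F(b^{uμ}) = B` and Cor R1′. [cite: MochizukiEtTh2009, §1 p.12] -/
theorem exists_eq_betaPow_of_twist_eq_powHat (U : Subgroup (GQp p)) [hU : U.FiniteIndex]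
    {g : F₂hatT} {μ : ZH} (hμ : bPow μ ≠ 1)
    (h : ∀ σ ∈ U, twist (chi p σ) (g * bPow μ * g⁻¹) = powHat (g * bPow μ * g⁻¹) (chi p σ zOne)) :
    ∃ s : ZH, g * bPow μ * g⁻¹ = betaPow s μ := by
  have hg : ∀ σ ∈ U, g⁻¹ * twist (chi p σ) g ∈ bAxis := by
    intro σ hσ
    have h1 := h σ hσ
    rw [map_mul, map_mul, map_inv, twist_bPow, powHat_conj, ← bPow_aut] at h1
    -- `θ(g) b^{χμ} θ(g)⁻¹ = g b^{χμ} g⁻¹` ⇒ `g⁻¹θ(g)` commutes with `b^{χμ}`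
    have hne : bPow (chi p σ μ) ≠ 1 := by
      rw [Ne, bPow_eq_one_iff]
      intro h0
      apply hμ
      rw [bPow_eq_one_iff]
      simpa using congrArg (chi p σ)⁻¹ h0
    apply mem_bAxis_of_commute_bPow hne
    calc g⁻¹ * twist (chi p σ) g * bPow (chi p σ μ)
        = g⁻¹ * (twist (chi p σ) g * bPow (chi p σ μ) * (twist (chi p σ) g)⁻¹) * twist (chi p σ) g := by group
      _ = g⁻¹ * (g * bPow (chi p σ μ) * g⁻¹) * twist (chi p σ) g := by rw [h1]
      _ = bPow (chi p σ μ) * (g⁻¹ * twist (chi p σ) g) := by group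
  obtain ⟨s, t, hst⟩ := Slice1.torusStable_holds p U g hg
  refine ⟨s, ?_⟩
  rw [hst]
  change powHat ea s * bPow t * bPow μ * (powHat ea s * bPow t)⁻¹ = aPow s * bPow μ * (aPow s)⁻¹
  -- `a^s b^t b^μ b^{-t} a^{-s} = a^s b^μ a^{-s}`
  have e : powHat ea s * bPow t * bPow μ * (powHat ea s * bPow t)⁻¹ =
      powHat ea s * (bPow t * bPow μ * (bPow t)⁻¹) * (powHat ea s)⁻¹ := by group
  rw [e, bPow_comm t μ, mul_inv_cancel_right, aPow]

namespace Residual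

/-- **S1 (i)**: `Ψ′(b) = b^{m₀}`. [cite: MochizukiEtTh2009, §1 p.12] -/
theorem exists_psi_eb (h : Residual p l U₀ m f' Ψ) : ∃ m₀ : ZH, Ψ eb = bPow m₀ := by
  obtain ⟨m₀, hm₀⟩ := (mem_bAxis_iff _).1 ((h.axis _ eb_mem_Uhat).1 eta_of_one_mem_bAxis)
  exact ⟨m₀, hm₀.symm⟩

/-- `Ψ′(b^t) = (Ψ′ b)^t`. [cite: MochizukiEtTh2009, §1 p.12] -/
theorem psi_bPow (h : Residual p l U₀ m f' Ψ) (t : ZH) : Ψ (bPow t) = powHat (Ψ eb) t := by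
  rw [bPow_eq_powHat, h.psi_powHat eb_mem_Uhat]

/-- **S1 (ii)**: `Ψ′(A)` is `θ_{U₀}`-fixed, hence an `a`-power by Thm R1: `Ψ′(a^L) = a^ν` whenever `l ∣ L`.
[cite: MochizukiEtTh2009, §1 p.12] -/
theorem exists_psi_aPow (h : Residual p l U₀ m f' Ψ) [hU : U₀.FiniteIndex] {L : ZH}
    (hL : ZHatLevel.level l L = 1) : ∃ ν : ZH, Ψ (aPow L) = aPow ν := by
  have hA : aPow L ∈ Uhat l := (aPow_mem_Uhat_iff L).2 hL
  exact Slice1.thetaFixedRigidityOn_holds p U₀ (Ψ (aPow L)) fun σ hσ => by rw [← h.torus σ hσ _ hA, twist_aPow]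

/-- `Ψ′` is injective against `1`: `Ψ′ x = 1 → x = 1` on `Û_l`. [cite: MochizukiEtTh2009, §1 p.12] -/
theorem eq_one_of_psi_eq_one (h : Residual p l U₀ m f' Ψ) {x : F₂hatT} (hx : x ∈ Uhat l) (h1 : Ψ x = 1) :
    x = 1 :=
  h.inj x hx 1 (one_mem _) (by rw [h1, h.psi_one])

/-- **S1 (iii) — CUSP IMAGES ARE AXIS CUSPS**: for a `b`-line element `β_{s₀}^{t₀} ∈ Û_l` with `b^{t₀} ≠ 1`,
`Ψ′(β_{s₀}^{t₀}) = β_s^{μ}` with `b^μ ≠ 1` — (C) + (θ) + `C_F(b^{uμ}) = B` + Cor R1′ on `U₀` (type-free; this is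
PL3-R1-READ's (4′)). [cite: MochizukiEtTh2009, §1 p.12] -/
theorem exists_psi_betaPow (h : Residual p l U₀ m f' Ψ) [hU : U₀.FiniteIndex] {s₀ t₀ : ZH}
    (hmem : betaPow s₀ t₀ ∈ Uhat l) (ht₀ : bPow t₀ ≠ 1) :
    ∃ s μ : ZH, Ψ (betaPow s₀ t₀) = betaPow s μ ∧ bPow μ ≠ 1 := by
  obtain ⟨g, μ, hg⟩ := (h.btype _ hmem).1 (isBType_betaPow s₀ t₀)
  have hμ : bPow μ ≠ 1 := by
    intro h0
    apply ht₀
    rw [h0, mul_one, mul_inv_cancel] at hg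
    have ht : t₀ = 1 := (betaPow_eq_one_iff s₀ t₀).1 (h.eq_one_of_psi_eq_one hmem hg)
    rw [ht]; exact _root_.map_one bPow
  have key : ∀ σ ∈ U₀, twist (chi p σ) (g * bPow μ * g⁻¹) = powHat (g * bPow μ * g⁻¹) (chi p σ zOne) := by
    intro σ hσ
    rw [← hg, ← h.torus σ hσ _ hmem, twist_betaPow_eq_powHat, h.psi_powHat hmem]
  obtain ⟨s, hs⟩ := exists_eq_betaPow_of_twist_eq_powHat U₀ hμ key
  exact ⟨s, μ, hg.trans hs, hμ⟩

/-- Images of commuting elements commute, and conversely (injective hom on `Û_l`). [cite: MochizukiEtTh2009, §1 p.12] -/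
theorem commute_iff (h : Residual p l U₀ m f' Ψ) {x y : F₂hatT} (hx : x ∈ Uhat l) (hy : y ∈ Uhat l) :
    Ψ x * Ψ y = Ψ y * Ψ x ↔ x * y = y * x := by
  constructor
  · intro hc
    have e : Ψ (x * y) = Ψ (y * x) := by rw [h.mul x hx y hy, h.mul y hy x hx, hc]
    exact h.inj _ (mul_mem hx hy) _ (mul_mem hy hx) e
  · intro hc
    rw [← h.mul x hx y hy, hc, h.mul y hy x hx]

end Residual

end S1

end Literature.AnabelianGeometry.EtaleTheta.SettingModel.Slice2

end
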